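import Summits.CriticalPhenomena.PercolationContinuityZ3.Theorems.PercNearOneGluingNoHeavyLowerTailHullPortCSHCellOne
import Summits.CriticalPhenomena.PercolationContinuityZ3.Theorems.PercNearOneGluingAdditiveGluingCSHHtwBridge
import HarnessLib

/-!
# `NoHeavyLowerTail` (stmt-CriticalPhenomena-4575) — the level-one cell of the conditioned slack hierarchy, UNCONDITIONALLY

Support file (prover `prim-ineq-prove-5`; `--supports stmt-CriticalPhenomena-4575`); no definitions, named facts or sorries.
The hypothesis (Htw) of `HullPort.csh_one` (`…HullPortCSHCellOne.lean`, `delE`/`cut` world-sum form) is discharged from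
`CSH.htw_world` (`…AdditiveGluingCSHHtwBridge.lean`, prim-png-lead-4576's world form of prim-hp-4's `CovTau.p1H_univ` = A2^H diagonal):
* `HullPort.htw_delE` — (Htw) in the `delE` shape of `csh_one`;
* `HullPort.csh_one_holds` — CSH(`Y; x; (d); o, v`)[Ψ] for every monotone `Ψ` of the open edge cluster of `x`, weights `< 1`, no hypothesis
  beyond distinctness — an independent second formalisation of the level-one cell (= prim-hp-8's CSL₂ / MDL2 / CSH(1,1) atom of SL(4,1), (S5)₃, GEN(4)).
[cite: VandenbergHaggstromKahn2005, Thm. 1.1 (pp. 3–5), Thms. 1.3–1.5 (pp. 6–7), §2.1 (pp. 9–13) — corollaries] [cite: Gladkov2024, Thm. 3.2 (p. 4)]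
-/

noncomputable section

namespace Summit.CriticalPhenomena.PercolationContinuityZ3.Theorems

open MeasureTheory Set Literature.Probability.LatticeModels Literature.Probability.Percolation
open scoped Classical

variable {V : Type*}

namespace HullPort

open LonePortSum LonePortSumGeneral BHK2006 DecisionTree KNPreFKG

section CSHCell

variable [Fintype V]

/-- The world weights of `CSH.htw_world` are the weights zeroed on `cut Y ω`. [folklore] -/
theorem worldWeights_eq_cut (q : Sym2 V → unitInterval) (Y : Set V) (ω : Set (Sym2 V)) :
    (fun e : Sym2 V => if (∃ z ∈ e, ∃ y ∈ Y, (openGraph ω).Reachable y z) then (0 : unitInterval) else q e) =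
      fun e => if e ∈ cut Y ω then 0 else q e := by
  funext e
  have hiff : (∃ z ∈ e, ∃ y ∈ Y, (openGraph ω).Reachable y z) ↔ e ∈ cut Y ω := Iff.rfl
  by_cases h : e ∈ cut Y ω
  · rw [if_pos (hiff.2 h), if_pos h]
  · rw [if_neg (fun hh => h (hiff.1 hh)), if_neg h]

/-- **(Htw) in `delE` form** (the hypothesis `HTW` of `HullPort.csh_one`), from `CSH.htw_world`. For weights `< 1`, `v ∉ {x, d} ∪ Y`,
`p·μ(v ↮ x,d,Y) = μ(v ↮ x,d,Y, v↔o)` and every monotone `g ≥ 0`: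
`0 ≤ Σ_ω w 1{x↮Y} (p_ω − p) Cov_{G − cut_Y ω}(g(C_x), 1{v ↔ {x,d}})`.
[cite: VandenbergHaggstromKahn2005, Thm. 1.1 (pp. 3–5) — via `CovTau.p1H_univ` / `CSH.htw_world`] -/
theorem htw_delE (q : Sym2 V → unitInterval) (hq : ∀ e, (q e : ℝ) < 1) (x d o v : V) (Y : Set V)
    (hvx : v ≠ x) (hvd : v ≠ d) (hvY : v ∉ Y) (p : ℝ)
    (hp : p * (prodBernoulli q).real {ω : BondConfig V | ∀ t ∈ insert d (insert x Y), ¬ (openGraph ω).Reachable v t} =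
      (prodBernoulli q).real ({ω : BondConfig V | ∀ t ∈ insert d (insert x Y), ¬ (openGraph ω).Reachable v t} ∩ openConn v o))
    (g : Set (Sym2 V) → ℝ) (hg : Monotone g) (hg0 : ∀ C, 0 ≤ g C) :
    0 ≤ ∑ ω, weight (fun e => (q e : ℝ)) ω * (ind (avoidEv x Y) ω *
      ((delE (fun e => (q e : ℝ)) (cut Y ω)
            (ind ({ζ : BondConfig V | ∀ s ∈ ({x, d} : Set V), ¬ (openGraph ζ).Reachable s v} ∩ openConn o v)) /
          delE (fun e => (q e : ℝ)) (cut Y ω)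
            (ind {ζ : BondConfig V | ∀ s ∈ ({x, d} : Set V), ¬ (openGraph ζ).Reachable s v}) - p) *
        covW (fun e => (q e : ℝ)) Y (fun η => g (openEdgeCluster η x))
          (ind {ζ : BondConfig V | ∃ s ∈ ({x, d} : Set V), (openGraph ζ).Reachable s v}) ω)) := by
  set ŵ : Sym2 V → ℝ := fun e => (q e : ℝ) with hŵ
  have hw0 : ∀ e, 0 ≤ ŵ e := fun e => (q e).2.1
  have hw1 : ∀ e, ŵ e ≤ 1 := fun e => (q e).2.2
  have hvS : v ∉ ({x, d} : Finset V) := by simp [hvx, hvd]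
  have key := CSH.htw_world q x Y ({x, d} : Finset V) (by simp) o v hvS g hg hg0
  -- set dictionary
  have hSset : (↑({x, d} : Finset V) ∪ Y : Set V) = insert d (insert x Y) := by
    ext a; simp only [Finset.coe_insert, Finset.coe_singleton, Set.mem_union, Set.mem_insert_iff, Set.mem_singleton_iff]; tauto
  have hA : {ω : BondConfig V | ∀ a ∈ (↑({x, d} : Finset V) ∪ Y : Set V), ¬ (openGraph ω).Reachable v a} =
      {ω : BondConfig V | ∀ t ∈ insert d (insert x Y), ¬ (openGraph ω).Reachable v t} := by rw [hSset]
  have hU : (⋃ t ∈ ({x, d} : Finset V), (openConn v t : Set (BondConfig V))) =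
      {ζ : BondConfig V | ∃ s ∈ ({x, d} : Set V), (openGraph ζ).Reachable s v} := by
    rw [← CSH.setOf_exists_reachable_eq_biUnion]; simp only [Finset.coe_insert, Finset.coe_singleton]
  have hDv : {η : BondConfig V | ∀ t ∈ ({x, d} : Finset V), ¬ (openGraph η).Reachable v t} =
      {ζ : BondConfig V | ∀ s ∈ ({x, d} : Set V), ¬ (openGraph ζ).Reachable s v} := by
    ext η
    simp only [Set.mem_setOf_eq, Finset.mem_insert, Finset.mem_singleton, Set.mem_insert_iff, Set.mem_singleton_iff]
    constructor
    · intro h s hs hsv; exact h s hs hsv.symm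
    · intro h t ht hvt; exact h t ht hvt.symm
  rw [hA, hU, hDv] at key
  simp only [worldWeights_eq_cut q Y] at key
  -- world quantities in `delE` form
  set Dv : Set (BondConfig V) := {ζ : BondConfig V | ∀ s ∈ ({x, d} : Set V), ¬ (openGraph ζ).Reachable s v} with hDvdef
  set VS : Set (BondConfig V) := {ζ : BondConfig V | ∃ s ∈ ({x, d} : Set V), (openGraph ζ).Reachable s v} with hVSdef
  set A : Set (BondConfig V) := {ω : BondConfig V | ∀ t ∈ insert d (insert x Y), ¬ (openGraph ω).Reachable v t} with hAdef
  have creal : ∀ (ω : Set (Sym2 V)) (E : Set (BondConfig V)),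
      (prodBernoulli fun e => if e ∈ cut Y ω then 0 else q e).real E = delE ŵ (cut Y ω) (ind E) := by
    intro ω E; rw [delE_eq_integral_zeroed, measureReal_eq_sum, integral_prodBernoulli_eq_sum]
  have cint : ∀ (ω : Set (Sym2 V)) (E : Set (BondConfig V)),
      ∫ η in E, g (openEdgeCluster η x) ∂(prodBernoulli fun e => if e ∈ cut Y ω then 0 else q e) =
        delE ŵ (cut Y ω) (fun η => g (openEdgeCluster η x) * ind E η) := by
    intro ω E; rw [delE_eq_integral_zeroed, setIntegral_eq_sum, integral_prodBernoulli_eq_sum]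
  have cint0 : ∀ ω : Set (Sym2 V), ∫ η, g (openEdgeCluster η x) ∂(prodBernoulli fun e => if e ∈ cut Y ω then 0 else q e) =
      delE ŵ (cut Y ω) (fun η => g (openEdgeCluster η x)) := fun ω => (delE_eq_integral_zeroed q _ _).symm
  have hcov : ∀ ω : Set (Sym2 V),
      (∫ η in VS, g (openEdgeCluster η x) ∂(prodBernoulli fun e => if e ∈ cut Y ω then 0 else q e)) -
        (prodBernoulli fun e => if e ∈ cut Y ω then 0 else q e).real VS *
          ∫ η, g (openEdgeCluster η x) ∂(prodBernoulli fun e => if e ∈ cut Y ω then 0 else q e) =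
      covW ŵ Y (fun η => g (openEdgeCluster η x)) (ind VS) ω := by
    intro ω; rw [cint, creal, cint0]; simp only [covW]; ring
  simp only [hcov] at key
  simp only [creal] at key
  have hp' := hp
  rw [openConn_symm v o] at hp'
  -- the outer integrals as world sums
  rw [setIntegral_eq_sum, setIntegral_eq_sum] at key
  have hDav : ∀ ω : Set (Sym2 V), ind {ω : BondConfig V | ∀ y ∈ Y, ¬ (openGraph ω).Reachable x y} ω = ind (avoidEv x Y) ω :=
    fun ω => rfl
  simp only [hDav] at key
  rw [← hp'] at key
  -- positivity of μ(A) and conclusion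
  have posA : 0 < (prodBernoulli q).real A := by
    rw [measureReal_eq_sum]
    have hmem : (∅ : Set (Sym2 V)) ∈ A := by
      intro t ht h
      rw [reachable_empty_iff] at h
      rcases Set.mem_insert_iff.1 ht with rfl | ht
      · exact hvd h
      · rcases Set.mem_insert_iff.1 ht with rfl | ht
        · exact hvx h
        · exact hvY (h ▸ ht)
    calc 0 < weight ŵ (∅ : Set (Sym2 V)) * ind A ∅ := by rw [ind_of_mem hmem, mul_one]; exact weight_empty_pos ŵ hq
      _ ≤ ∑ ω, weight ŵ ω * ind A ω := Finset.single_le_sum (f := fun ω => weight ŵ ω * ind A ω)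
          (fun ω _ => mul_nonneg (weight_nonneg hw0 hw1 ω) (ind_nonneg _ _)) (Finset.mem_univ _)
  have key' : (prodBernoulli q).real A * (p * ∑ ω, weight ŵ ω * (covW ŵ Y (fun η => g (openEdgeCluster η x)) (ind VS) ω *
      ind (avoidEv x Y) ω)) ≤ (prodBernoulli q).real A * ∑ ω, weight ŵ ω *
        (delE ŵ (cut Y ω) (ind (Dv ∩ openConn o v)) / delE ŵ (cut Y ω) (ind Dv) *
          covW ŵ Y (fun η => g (openEdgeCluster η x)) (ind VS) ω * ind (avoidEv x Y) ω) := by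
    have : p * (prodBernoulli q).real A * ∑ ω, weight ŵ ω * (covW ŵ Y (fun η => g (openEdgeCluster η x)) (ind VS) ω *
        ind (avoidEv x Y) ω) = (prodBernoulli q).real A * (p * ∑ ω, weight ŵ ω *
          (covW ŵ Y (fun η => g (openEdgeCluster η x)) (ind VS) ω * ind (avoidEv x Y) ω)) := by ring
    rw [← this]; exact key
  have hfin := le_of_mul_le_mul_left key' posA
  rw [Finset.mul_sum] at hfin
  have : ∑ ω, weight ŵ ω * (ind (avoidEv x Y) ω *
      ((delE ŵ (cut Y ω) (ind (Dv ∩ openConn o v)) / delE ŵ (cut Y ω) (ind Dv) - p) *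
        covW ŵ Y (fun η => g (openEdgeCluster η x)) (ind VS) ω)) =
      (∑ ω, weight ŵ ω * (delE ŵ (cut Y ω) (ind (Dv ∩ openConn o v)) / delE ŵ (cut Y ω) (ind Dv) *
          covW ŵ Y (fun η => g (openEdgeCluster η x)) (ind VS) ω * ind (avoidEv x Y) ω)) -
        ∑ ω, p * (weight ŵ ω * (covW ŵ Y (fun η => g (openEdgeCluster η x)) (ind VS) ω * ind (avoidEv x Y) ω)) := by
    rw [← Finset.sum_sub_distrib]; exact Finset.sum_congr rfl fun ω _ => by ring
  rw [this]
  linarith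

/-- **The level-one cell of the conditioned slack hierarchy, unconditionally** (`HullPort.csh_one` with (Htw) discharged by
`HullPort.htw_delE`): for weights `< 1`, owner `x`, avoided set `Y`, decoy `d ∉ {x} ∪ Y`, observers `o, v` (`o, v ≠ x, d`; `v ∉ Y`),
constants `p = μ(v↔o | v ↮ x,d,Y)`, `c_u = μ(d↔u | d ↮ x,Y)` and every monotone `Ψ` of the open edge cluster of `x`:
`0 ≤ μ(D)∫_D Ψ(C_x) h(C_x) − (∫_D Ψ(C_x))(∫_D h(C_x))`, `D = {x ↮ Y}`, `h = 1_o − c_o 1_d − p(1_v − c_v 1_d)`.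
[cite: VandenbergHaggstromKahn2005, Thms. 1.1–1.5, §2.1 (pp. 3–13) — corollaries] [cite: Gladkov2024, Thm. 3.2 (p. 4)] -/
theorem csh_one_holds (q : Sym2 V → unitInterval) (hq : ∀ e, (q e : ℝ) < 1) (x d o v : V) (Y : Set V)
    (hdx : d ≠ x) (hdY : d ∉ Y) (hdo : d ≠ o) (hvd : v ≠ d) (hvx : v ≠ x) (hvY : v ∉ Y) (hox : o ≠ x)
    (Ψ : Set (Sym2 V) → ℝ) (hΨ : Monotone Ψ) (p co cv : ℝ)
    (hp : p * (prodBernoulli q).real {ω : BondConfig V | ∀ t ∈ insert d (insert x Y), ¬ (openGraph ω).Reachable v t} =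
      (prodBernoulli q).real ({ω : BondConfig V | ∀ t ∈ insert d (insert x Y), ¬ (openGraph ω).Reachable v t} ∩ openConn v o))
    (hco : co * (prodBernoulli q).real {ω : BondConfig V | ∀ t ∈ insert x Y, ¬ (openGraph ω).Reachable d t} =
      (prodBernoulli q).real ({ω : BondConfig V | ∀ t ∈ insert x Y, ¬ (openGraph ω).Reachable d t} ∩ openConn d o))
    (hcv : cv * (prodBernoulli q).real {ω : BondConfig V | ∀ t ∈ insert x Y, ¬ (openGraph ω).Reachable d t} =
      (prodBernoulli q).real ({ω : BondConfig V | ∀ t ∈ insert x Y, ¬ (openGraph ω).Reachable d t} ∩ openConn d v)) :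
    0 ≤ (prodBernoulli q).real {ω : BondConfig V | ∀ y ∈ Y, ¬ (openGraph ω).Reachable x y} *
        (∫ ω in {ω : BondConfig V | ∀ y ∈ Y, ¬ (openGraph ω).Reachable x y},
          Ψ (openEdgeCluster ω x) *
            (ind {C : Set (Sym2 V) | ∃ e ∈ C, o ∈ e} (openEdgeCluster ω x) -
              co * ind {C : Set (Sym2 V) | ∃ e ∈ C, d ∈ e} (openEdgeCluster ω x) -
              p * (ind {C : Set (Sym2 V) | ∃ e ∈ C, v ∈ e} (openEdgeCluster ω x) -
                cv * ind {C : Set (Sym2 V) | ∃ e ∈ C, d ∈ e} (openEdgeCluster ω x))) ∂(prodBernoulli q)) -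
      (∫ ω in {ω : BondConfig V | ∀ y ∈ Y, ¬ (openGraph ω).Reachable x y}, Ψ (openEdgeCluster ω x) ∂(prodBernoulli q)) *
        (∫ ω in {ω : BondConfig V | ∀ y ∈ Y, ¬ (openGraph ω).Reachable x y},
          (ind {C : Set (Sym2 V) | ∃ e ∈ C, o ∈ e} (openEdgeCluster ω x) -
              co * ind {C : Set (Sym2 V) | ∃ e ∈ C, d ∈ e} (openEdgeCluster ω x) -
              p * (ind {C : Set (Sym2 V) | ∃ e ∈ C, v ∈ e} (openEdgeCluster ω x) -
                cv * ind {C : Set (Sym2 V) | ∃ e ∈ C, d ∈ e} (openEdgeCluster ω x))) ∂(prodBernoulli q)) :=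
  csh_one q hq x d o v Y hdx hdY hdo hvd hvx hvY hox Ψ hΨ p co cv hp hco hcv
    (fun g hg hg0 => htw_delE q hq x d o v Y hvx hvd hvY p hp g hg hg0)

end CSHCell

end HullPort

end Summit.CriticalPhenomena.PercolationContinuityZ3.Theorems
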